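import Summits.HubbardSuperconductivity.HubbardSuperconductivity.Theses.PlaquetteBoson
import Summits.HubbardSuperconductivity.HubbardSuperconductivity.Theorems.PlaquetteBosonPbInterpolation
import Literature.MathematicalPhysics.QuantumLattice.PlaquettePairCouplings
import HarnessLib

/-!
# Crux `PbAnchorOrder` (stmt-HubbardSuperconductivity-0905; route `PlaquetteBoson` rank 3, shared as the
support `AnchorOrder` of routes `AnisotropyChord` and `PolyaSchurPairBoson`) — BIRTH SKELETON
`Lines/birth.lean` (BC3; registrar `planner-skel-stmt-HubbardSuperconductivity-0905-0`, 2026-08-17,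
mode skeleton-register: no new routes, no proving beyond the assembly)

THE CRUX (fixed; `Theses/PlaquetteBoson.lean`, decl `PbAnchorOrder`, rev 4, not restated): there are
`U > 0`, a hole doping `δ ∈ (0, 1/2)` and `t₀ > 0` such that for every inter-plaquette hopping
`t' ∈ (0, t₀)`, eventually in `L ∈ 4ℕ`, every normalised `(N_L, S^z = 0)`-sector ground state of the
CHECKERBOARD Hubbard torus `H_L(t', U) = hamiltonian G_intra 1 U + hamiltonian G_inter t' 0`
(`2 × 2` plaquettes `{2a,2a+1} × {2b,2b+1}` with `t = 1` and on-site `U`, glued by `t'`;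
`N_L = 2⌊(1-δ)L²/2⌋`) has `d_{x²-y²}` pair-field order `c(t')·L⁴ ≤ re ⟨ψ, Δ_d† Δ_d ψ⟩`.

THE LINE = the crux's own intended second layer (route header "INTENDED SECOND LAYER (i)–(iv)";
sibling route `PolyaSchurPairBoson`, two-layer plan `DressAnyFilling ⇐ KineticGlueInWindow →
SchriefferWolffPlaquette → DressingStability`), cut at its three natural joints — a CERTIFIED
COMPUTATION, a BOSONIC many-body input, and the FERMIONIC perturbative transfer — now TYPED, because the
definition request `plaquettePairCouplings U` (J(U), V(U), Δ_pb(U), c(U), `ΔEff = -V/2J`;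
`Literature/…/PlaquettePairCouplings.lean`) has landed:

1. `stub_plaquetteWindow` — THE LOCK-IN LANDS INSIDE THE WINDOW (certified exact diagonalisation of
   one and two plaquettes; `KineticGlueInWindow` of the sibling plan): `∃ U > 0` with
   `PlaquetteWindowAt U` — nondegenerate, spin-SINGLET `(4,0)`/`(2,0)` plaquette ground states
   (uniqueness in the `S^z = 0` sector and a strict gap to the `S^z = 1` sector), pair binding
   `2E(1h) - E(0h) - E(2h) > 0`, pair exclusion `E(0h) + E(4h) - 2E(2h) > 0`, no three-hole plaquettes
   `3E(2h) < 2E(3h) + E(0h)` (together: among all hole distributions over plaquettes the `{0h, 2h}`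
   configurations are the unique minimisers, with a gap), pair hopping `J(U) > 0` (uniform, not
   `(π,π)`, condensate — else the order is invisible to `Δ_d`), `0 ≤ V(U) < 2J(U)` (the effective
   anisotropy `Δ_eff(U) = -V/2J` lies in the easy-plane interval `(-1, 0]` where the bosonic input is
   stated) and the `B₁g` selection rule `c(U) = ⟨2h|Δ_d^{(R)}|0h⟩ > 0`. Uncertified ED (route headers):
   `V/2J = 0.986, 0.993` at `U = 1, 2` (margin ~1 %), `Δ_pb > 0` for `0 < U < U_c ≈ 4.58`,
   `V/t⁽¹⁾ = 2` exactly at `U_s ≈ 2.7` (Yao–Tsai–Kivelson 2007 p. 4). Why it might fail: `V ≥ 2J` on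
   the whole binding window, or `J < 0`. Size M (interval arithmetic on ≤ 36-dim blocks and the
   `4 × 4` two-plaquette kernel; cf. the certified-ED machinery of
   `Theorems/CooperPairDMottWalkPlaquette*.lean` for `U ∈ [2,4]`).
2. `stub_easyPlaneCondensate` — THE BOSONIC INPUT: easy-plane condensation of the `S = ½`
   ferro-XY/AF-Ising torus gas (= hard-core bosons, hopping `½`, n.n. repulsion `-Δ`) at EVERY
   anisotropy `Δ ∈ (-1, 0]` and EVERY filling `ρ ∈ (0, ½]`: `c(Δ,ρ)·M⁴ ≤ ⟨ψ, S⁺_tot S⁻_tot ψ⟩` for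
   normalised sector ground states, eventually in even `M`. VERBATIM the consequent of this route's
   proved support `PbInterpolation` (stmt-0908, `Theorems.PlaquetteBoson.pbInterpolation_proof`), hence
   DISCHARGED BY THE ROUTE'S OWN CRUXES `PbMonotoneDepletion` (0904, rank 2) and `PbHalfFilledXYOrder`
   (0906, rank 4) — see `easyPlaneCondensate_of_routeItems` below (proved, no sorry); verbatim also the
   target `EasyPlaneCondensate` (stmt-10288) of route `PolyaSchurPairBoson` (a second engine). Open
   since 1988 off the reflection-positive half-filled point (LSSY 2005 ch. 11). Size: crux-sized, but
   NOT this crux's residual — it is staffed through 0904/0906/10288.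
3. `stub_dressing` — SCHRIEFFER–WOLFF + DRESSING AT FIXED `U` (the crux's residual, `(ii)+(iv)` of the
   route header): for every `U > 0` with `PlaquetteWindowAt U` and every doping `δ ∈ (0, ¼]`
   (boson filling `ρ_b = 2δ ≤ ½`; `N_L = L² - 2N_b`, `N_b = ⌈2δM²⌉` hole pairs on the `M = L/2`
   plaquette torus), easy-plane condensation AT THE ONE POINT `(Δ_eff(U), 2δ)` implies the anchor body
   `AnchorOrderAt U δ` (some `t₀(U,δ) > 0`, all `t' ∈ (0,t₀)`, eventually in `L ∈ 4ℕ`, every sector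
   ground state of `H_L(t',U)` has `c·L⁴ ≤ re⟨Δ_d†Δ_d⟩`). Content: second-order Schrieffer–Wolff
   `H_L(t',U) ≅ E₀ + t'²·2J(U)·[xxzHamiltonian 1 (torusGraph 2 M) (-1) (Δ_eff U) + fields] ⊕ gapped
   sectors + R`, `‖R‖ = O(t'³/Δ_pb²)` per plaquette (Kato reduced resolvent, `interClusterKernel`;
   only two-plaquette terms occur at second order), and the DRESSING LEMMA: the gapless `U(1)` order of
   the `t'²`-scale gas survives the extensive non-reflection-positive remainder uniformly in `L` and
   projects onto the microscopic `Δ_d` with weight `c(U)² > 0`. Why it might fail = the crux's: no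
   LRO-stability theorem for gapless order under extensive perturbations (Datta–Fernández–Fröhlich
   1996 needs a gap; Bravyi–Hastings–Michalakis stability is for gapped/topological order);
   `t₀(U) → 0` as `U → 0`. Intended children (filed by a planner at the first split, not here):
   `SchriefferWolffPlaquette` (operator identity, provable: finite-dimensional Kato theory, DFF1996
   class) and `DressingStability` (the open analysis). Size: L (the hard stub).

COMPOSITION `PbAnchorOrder_of : Sig.stub_plaquetteWindow → Sig.stub_easyPlaneCondensate →
Sig.stub_dressing → PbAnchorOrder` (proved, no sorry; real arithmetic + instantiation): take `U` from
stub 1; the window inequalities `0 < J`, `0 ≤ V < 2J` put `Δ_eff(U) = -V/(2J)` in `(-1, 0]`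
(`ΔEff_mem_Ioc`); choose the witness doping `δ := 1/8` (any `δ ∈ (0, ¼]` works:
`anchorOrderAt_of_parts`), so `ρ_b = 2δ = ¼ ∈ (0, ½]`; stub 2 at `(Δ_eff(U), ¼)` feeds stub 3, whose
conclusion `AnchorOrderAt U (1/8)` is the crux body; `PbAnchorOrder_proof : PbAnchorOrder` is the
hypothesis-free A12 form (its only `sorryAx` dependence is through the three stubs).

DISPROOF USED: no `Cruxes/PbAnchorOrder/Disproof.lean` exists (2026-08-17; `ledger crux ls` empty); no
landed Negative lemma concerns this crux. `ledger negatives --problem HubbardSuperconductivity` (2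
entries) was read: (1) `CooperPairDMottWalk.BreathingSelfDual` (stmt-1180, intra/inter self-duality of
THIS checkerboard family at every even `L`) is false at the degenerate side `L = 2` only
(`not_breathingSelfDual`; repaired `breathingSelfDual_of_four_le`) — no stub here asserts self-duality,
and every statement is eventual in `L ∈ 4ℕ`; (2) `AposterioriCapRg.KlsOrderOpenness` (stmt-1314:
momentum-zero XY order is stable under ALL small translation-covariant `U(1)`-invariant finite-range
perturbations) is FALSE — helical Dzyaloshinskii–Moriya terms wind the order into a spiral invisible at
`q = 0` (`AposterioriCapRgKlsOrderOpenness_refuted`). `stub_dressing` is NOT an instance: its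
perturbation is the specific Schrieffer–Wolff remainder of a REAL (time-reversal even), lattice-inversion
symmetric Hamiltonian, for which DM terms (purely imaginary, inversion-odd bond operators) cannot occur;
but the lesson binds the intended child `DressingStability`: any abstract stability lemma must pin the
ordering wave vector (reality + site-inversion covariance of the perturbation, or a gauge-invariant
`sup_q` order parameter), never "all `U(1)`-invariant finite-range perturbations". Honoured constraints
from the route's refuter/grounder notes: every order statement is `⟨Δ†Δ⟩`-type LRO of fixed-`N` sector
ground states (barrier `LROForcesLowLyingStates` respected); `L ∈ 4ℕ` kept (RP on the `(L/2)`-torus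
needs even side); the stoquastic/sector conventions of the XXZ dictionary are the route file's verbatim.

Sources: H. Yao, W.-F. Tsai, S. A. Kivelson, PRB 76 (2007) 161104(R) = arXiv:0706.0761, eqs. (1)–(2),
p. 4 [YaoTsaiKivelson2007]; W.-F. Tsai, S. A. Kivelson, PRB 73 (2006) 214510, Table I, App. A
[TsaiKivelson2006]; E. Altman, A. Auerbach, PRB 65 (2002) 104508 §II.D [AltmanAuerbach2002];
T. Kennedy, E. H. Lieb, B. S. Shastry, PRL 61 (1988) 2582 [KLS1988PRL]; K. Kubo, T. Kishi, PRL 61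
(1988) 2585 [KuboKishi1988]; E. H. Lieb, R. Seiringer, J. P. Solovej, J. Yngvason (2005) ch. 11
[LiebSeiringerSolovejYngvason2005]; N. Datta, R. Fernández, J. Fröhlich, J. Stat. Phys. 84 (1996) 455
[DattaFernandezFrohlich1996]; T. Kato (1966) II-§2 [Kato1966]. No Literature definition is introduced;
the four `def`s below are local vocabulary over existing declarations.
-/

noncomputable section

-- `dupNamespace`: the summit and the problem are both named `HubbardSuperconductivity` (layout D-0022)
set_option linter.dupNamespace false

namespace Summit.HubbardSuperconductivity.HubbardSuperconductivity.Cruxes.PbAnchorOrder.Birth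

open Matrix Finset
open Literature.Probability.LatticeModels Literature.MathematicalPhysics.QuantumLattice
open Summit.HubbardSuperconductivity.HubbardSuperconductivity.Theses.PlaquetteBoson
  (PbAnchorOrder PbMonotoneDepletion PbHalfFilledXYOrder PbInterpolation)
open Summit.HubbardSuperconductivity.HubbardSuperconductivity.Theorems.PlaquetteBoson
  (pbInterpolation_proof)
open scoped ComplexOrder

/-! ### Vocabulary (plain `def`s over existing declarations) -/

/-- The CHECKERBOARD Hubbard torus `H_L(t', U)` of the crux, verbatim: intra-plaquette bonds (same
plaquette label `x ↦ (⌊x₀/2⌋, ⌊x₁/2⌋)`, i.e. the torus graph MINUS the "different label" relation) carry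
hopping `1` and the on-site `U`; inter-plaquette bonds (torus graph `⊓` "different label") carry hopping
`t'` and no second `U`. `H_L(1, U) = hubbardTorus 2 L 1 U` (`CooperPairDMottWalk.BreathingAtOneIsPure`).
Yao–Tsai–Kivelson 2007, eq. (1). -/
def checkerboardHamiltonian (L : ℕ) (t' U : ℝ) :
    Matrix (Finset (Orb (FermionTorus 2 L))) (Finset (Orb (FermionTorus 2 L))) ℂ :=
  hamiltonian ((fermionTorusGraph 2 L) \ SimpleGraph.comap
      (fun x : FermionTorus 2 L => fun i : Fin 2 => ((ofLex x) i : ℕ) / 2) ⊤) 1 U +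
    hamiltonian ((fermionTorusGraph 2 L) ⊓ SimpleGraph.comap
      (fun x : FermionTorus 2 L => fun i : Fin 2 => ((ofLex x) i : ℕ) / 2) ⊤) t' 0

/-- `AnchorOrderAt U δ` — the BODY of the crux at a fixed coupling `U` and doping `δ`, verbatim:
`∃ t₀ > 0, ∀ t' ∈ (0,t₀), ∃ c > 0, ∃ L₀, ∀ L ≥ L₀` with `4 ∣ L`, every normalised
`(N_L, S^z = 0)`-sector ground state `ψ` of `H_L(t', U)`, `N_L = 2⌊(1-δ)L²/2⌋`, has
`c L⁴ ≤ re ⟨ψ, Δ_d† Δ_d ψ⟩` (`Δ_d = pairField dWaveFormFactor L`). So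
`PbAnchorOrder ↔ ∃ U > 0, ∃ δ ∈ (0,1/2), AnchorOrderAt U δ` (`pbAnchorOrder_iff`, by `rfl`). -/
def AnchorOrderAt (U δ : ℝ) : Prop :=
  ∃ t₀ : ℝ, 0 < t₀ ∧ ∀ t' ∈ Set.Ioo (0:ℝ) t₀, ∃ c : ℝ, 0 < c ∧ ∃ L₀ : ℕ, ∀ (L : ℕ) [NeZero L],
    L₀ ≤ L → 4 ∣ L → ∀ (N : ℕ) (ψ : Fock (Orb (FermionTorus 2 L))),
      N = 2 * ⌊(1 - δ) * (L : ℝ) ^ 2 / 2⌋₊ → star ψ ⬝ᵥ ψ = 1 →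
      IsGroundStateInSector (checkerboardHamiltonian L t' U) N 0 ψ →
      c * (L : ℝ) ^ 4 ≤ (expect ((pairField dWaveFormFactor L)ᴴ * pairField dWaveFormFactor L) ψ).re

/-- `BosonCondensate Δ ρ` — easy-plane condensation of the `S = ½` ferro-XY/AF-Ising torus gas
`xxzHamiltonian 1 (torusGraph 2 M) (-1) Δ` (hard-core bosons = up spins, hopping `½`, n.n. repulsion
`-Δ`) on the filling window `[ρ, ½]`: `∃ c > 0, ∃ M₀`, for every even `M ≥ M₀`, every `N` with
`ρ M² ≤ N ≤ M²/2` and every normalised ground state `ψ` of the sector `S^z_tot = N - M²/2`,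
`c M⁴ ≤ re ⟨ψ, S⁺_tot S⁻_tot ψ⟩`. Verbatim the inner block of `PlaquetteBoson.PbInterpolation` /
`PolyaSchurPairBoson.EasyPlaneCondensate`. -/
def BosonCondensate (Δ ρ : ℝ) : Prop :=
  ∃ c : ℝ, 0 < c ∧ ∃ M₀ : ℕ, ∀ (M : ℕ) [NeZero M], Even M → M₀ ≤ M → ∀ N : ℕ,
    ρ * (M : ℝ) ^ 2 ≤ (N : ℝ) → 2 * N ≤ M ^ 2 →
    ∀ (ψ : TensorIndex (TorusSite 2 M) 2 → ℂ),
      ψ ∈ spinZSector (Λ := TorusSite 2 M) 1 ((N : ℝ) - (M : ℝ) ^ 2 / 2) → star ψ ⬝ᵥ ψ = 1 →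
      Matrix.mulVec (xxzHamiltonian 1 (torusGraph 2 M) (-1) Δ) ψ =
        ((lowestEnergyInSector 1 (xxzHamiltonian 1 (torusGraph 2 M) (-1) Δ)
          ((N : ℝ) - (M : ℝ) ^ 2 / 2) : ℝ) : ℂ) • ψ →
      c * (M : ℝ) ^ 4 ≤ (star ψ ⬝ᵥ Matrix.mulVec
        ((∑ x : TorusSite 2 M, onSite x (spinRaise 1)) * (∑ y : TorusSite 2 M, onSite y (spinLower 1)))
        ψ).re

/-- `PlaquetteWindowAt U` — the finite list of ONE/TWO-PLAQUETTE INEQUALITIES the line needs at the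
coupling `U` (all certifiable by interval exact diagonalisation; `plaquetteHamiltonian U =
hubbardTorus 2 2 1 U`, `E(Q) = plaquetteEnergy U Q` = ground energy with `Q` holes):
(a) the `(N, S^z) = (4, 0)` and `(2, 0)` plaquette ground states are nondegenerate (so the chosen
states `plaquetteVacuum U`, `plaquettePair U` and every number below are canonical) and (a') they are
spin SINGLETS: the `S^z = 0` sector minimum lies strictly below the `S^z = 1` sector minimum for
`N = 4` and `N = 2` (by `SU(2)` this excludes every `S ≥ 1` multiplet at the ground energy, so the
low-energy manifold carries no spin); (b) pair binding `2E(1) - E(0) - E(2) > 0`, pair exclusion `E(0) + E(4) - 2E(2) > 0` and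
no three-hole plaquettes `3E(2) < 2E(3) + E(0)` — equivalently `Q ↦ E(Q)` lies strictly above the
chord through `Q = 0, 2` at `Q = 1, 3, 4`, i.e. for every total hole number `2N_b ≤ M²` the hole
distributions using only `0`-hole and `2`-hole plaquettes are the unique minimisers of `Σ_p E(Q_p)`,
with a uniform gap (the low-energy manifold of the Schrieffer–Wolff reduction); (c) uniform pair
hopping `J(U) > 0` and repulsion in the easy-plane window `0 ≤ V(U) < 2J(U)` (`Δ_eff ∈ (-1, 0]`,
`ΔEff_mem_Ioc`); (d) the `B₁g` selection rule `c(U) = ⟨2h| Δ_d^{(R)} |0h⟩ > 0`.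
Yao–Tsai–Kivelson 2007 p. 2, p. 4; Tsai–Kivelson 2006 Table I; Altman–Auerbach 2002 §II.D. -/
def PlaquetteWindowAt (U : ℝ) : Prop :=
  (∀ φ₁ φ₂ : Fock (Orb PlaquetteSite), IsGroundStateInSector (plaquetteHamiltonian U) 4 0 φ₁ →
      IsGroundStateInSector (plaquetteHamiltonian U) 4 0 φ₂ → ∃ a : ℂ, φ₂ = a • φ₁) ∧
  (∀ φ₁ φ₂ : Fock (Orb PlaquetteSite), IsGroundStateInSector (plaquetteHamiltonian U) 2 0 φ₁ →
      IsGroundStateInSector (plaquetteHamiltonian U) 2 0 φ₂ → ∃ a : ℂ, φ₂ = a • φ₁) ∧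
  (plaquetteHamiltonian U).minEnergyOn (szSector 4 0) <
    (plaquetteHamiltonian U).minEnergyOn (szSector 4 1) ∧
  (plaquetteHamiltonian U).minEnergyOn (szSector 2 0) <
    (plaquetteHamiltonian U).minEnergyOn (szSector 2 1) ∧
  0 < (plaquettePairCouplings U).pairBinding ∧
  0 < (plaquettePairCouplings U).pairExclusion ∧
  3 * plaquetteEnergy U 2 < 2 * plaquetteEnergy U 3 + plaquetteEnergy U 0 ∧
  0 < (plaquettePairCouplings U).J ∧
  0 ≤ (plaquettePairCouplings U).V ∧
  (plaquettePairCouplings U).V < 2 * (plaquettePairCouplings U).J ∧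
  0 < (plaquettePairCouplings U).c

/-! ### Stub signatures (`Sig.stub_*`: the hypothesis heads of `PbAnchorOrder_of` carry the stub names) -/

/-- STUB 1 signature — the lock-in lands inside the window: some repulsive `U` satisfies every
plaquette inequality of `PlaquetteWindowAt`. -/
def Sig.stub_plaquetteWindow : Prop :=
  ∃ U : ℝ, 0 < U ∧ PlaquetteWindowAt U

/-- STUB 2 signature — easy-plane condensation at every `(Δ, ρ) ∈ (-1, 0] × (0, ½]` (verbatim the
consequent of `PlaquetteBoson.PbInterpolation`, discharged by cruxes 0904 + 0906:
`easyPlaneCondensate_of_routeItems`). -/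
def Sig.stub_easyPlaneCondensate : Prop :=
  ∀ Δ ∈ Set.Ioc (-1:ℝ) 0, ∀ ρ ∈ Set.Ioc (0:ℝ) (1/2), BosonCondensate Δ ρ

/-- STUB 3 signature — Schrieffer–Wolff + dressing at fixed `U`: inside the window, easy-plane
condensation of the effective gas at the single point `(Δ_eff(U), 2δ)` gives the anchor body at
`(U, δ)` for every `δ ∈ (0, ¼]`. -/
def Sig.stub_dressing : Prop :=
  ∀ U : ℝ, 0 < U → PlaquetteWindowAt U → ∀ δ ∈ Set.Ioc (0:ℝ) (1/4),
    BosonCondensate (plaquettePairCouplings U).ΔEff (2 * δ) → AnchorOrderAt U δ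

/-! ### Registered stubs (sorries live ONLY here) -/

/-- **STUB 1 `stub_plaquetteWindow` — THE LOCK-IN LANDS INSIDE THE WINDOW** (certified computation on
one and two `2 × 2` plaquettes; `KineticGlueInWindow` of the sibling plan, typed over the landed
`plaquettePairCouplings`). Some `U > 0` has nondegenerate singlet `(4,0)`/`(2,0)` plaquette ground
states (strict gap to the `S^z = 1` sectors), pair binding, pair exclusion, no three-hole plaquettes, `J(U) > 0`, `0 ≤ V(U) < 2J(U)` and `c(U) > 0`.
Uncertified ED: `V/2J = 0.986 (U = 1), 0.993 (U = 2)`, `Δ_pb(U) > 0` on `(0, 4.58)`; the natural target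
is `U ∈ [1, 2]`. Why it might fail: the `1 %` margin of `V < 2J` does not survive certification, or
`J < 0` (a `(π,π)` pair-density wave invisible to `Δ_d`). Yao–Tsai–Kivelson 2007 p. 4; Tsai–Kivelson
2006 Table I, App. A. -/
theorem stub_plaquetteWindow :
    ∃ U : ℝ, 0 < U ∧ PlaquetteWindowAt U := by
  sorry

/-- **STUB 2 `stub_easyPlaneCondensate` — THE BOSONIC INPUT** (easy-plane condensation of the
hard-core torus gas at every anisotropy `Δ ∈ (-1, 0]` and filling `ρ ∈ (0, ½]`). Verbatim the
consequent of the proved support `PbInterpolation` — so `PbMonotoneDepletion → PbHalfFilledXYOrder →`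
this (`easyPlaneCondensate_of_routeItems`) — and verbatim `PolyaSchurPairBoson.EasyPlaneCondensate`
(stmt-10288). Known only at the reflection-positive point `ρ = ½`, `|Δ| ≲ 0.2` (KLS 1988, Kubo–Kishi
1988; tree `kennedy_lieb_shastry_xy_ground_holds` at `Δ = 0`); open elsewhere (LSSY 2005 ch. 11). -/
theorem stub_easyPlaneCondensate :
    ∀ Δ ∈ Set.Ioc (-1:ℝ) 0, ∀ ρ ∈ Set.Ioc (0:ℝ) (1/2), BosonCondensate Δ ρ := by
  sorry

/-- **STUB 3 `stub_dressing` — SCHRIEFFER–WOLFF + DRESSING AT FIXED `U`** (the crux's residual). For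
every `U > 0` inside the plaquette window and every doping `δ ∈ (0, ¼]`: if the effective `S = ½`
easy-plane gas at the plaquette anisotropy `Δ_eff(U) = -V(U)/2J(U)` condenses on the filling window
`[2δ, ½]` (it contains the hole-pair number `N_b = ⌈2δM²⌉` of the sector `N_L = 2⌊(1-δ)L²/2⌋`,
`M = L/2`, for every `L ∈ 4ℕ`), then for some `t₀ = t₀(U, δ) > 0` and all `t' ∈ (0, t₀)` every
normalised sector ground state of the checkerboard torus `H_L(t', U)` has `c(t')·L⁴ ≤ re⟨Δ_d†Δ_d⟩`
eventually in `L ∈ 4ℕ`. Mechanism: second-order Schrieffer–Wolff onto the `{0h, 2h}` plaquette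
manifold (isolated by (a)–(b) of the window) gives `t'²·2J(U)·[xxzHamiltonian 1 (torusGraph 2 M) (-1)
(Δ_eff U) + constant fields]` plus `R = O(t'³/Δ_pb²)` per plaquette; the dressing lemma transports the
condensate through `R` uniformly in `L` and projects the plaquette boson onto `Δ_d` with weight
`c(U)² > 0`. Why it might fail: no stability theorem for GAPLESS `U(1)` order under an extensive
non-reflection-positive perturbation (DFF 1996 needs a gap); `t₀(U) → 0` as `U → 0`.
Yao–Tsai–Kivelson 2007 eq. (2); Datta–Fernández–Fröhlich 1996; Kato 1966 II-§2. -/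
theorem stub_dressing :
    ∀ U : ℝ, 0 < U → PlaquetteWindowAt U → ∀ δ ∈ Set.Ioc (0:ℝ) (1/4),
      BosonCondensate (plaquettePairCouplings U).ΔEff (2 * δ) → AnchorOrderAt U δ := by
  sorry

/-! ### Bookkeeping (proved) -/

/-- The crux unfolds to `∃ U > 0, ∃ δ ∈ (0, 1/2), AnchorOrderAt U δ`. [bookkeeping] -/
theorem pbAnchorOrder_iff :
    PbAnchorOrder ↔ ∃ U : ℝ, 0 < U ∧ ∃ δ ∈ Set.Ioo (0:ℝ) (1/2), AnchorOrderAt U δ :=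
  Iff.rfl

/-- Stub 2 is literally the consequent of the proved support `PbInterpolation`
(`Theorems.PlaquetteBoson.pbInterpolation_proof`): the route's cruxes `PbMonotoneDepletion` (0904) and
`PbHalfFilledXYOrder` (0906) discharge it. [bookkeeping] -/
theorem easyPlaneCondensate_of_routeItems (hMD : PbMonotoneDepletion) (hHF : PbHalfFilledXYOrder) :
    Sig.stub_easyPlaneCondensate :=
  pbInterpolation_proof hMD hHF

/-- Real arithmetic of the window: `0 < J` and `0 ≤ V < 2J` put `Δ_eff = -V/(2J)` in `(-1, 0]`.
[bookkeeping] -/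
theorem ΔEff_mem_Ioc {U : ℝ} (hJ : 0 < (plaquettePairCouplings U).J)
    (hV0 : 0 ≤ (plaquettePairCouplings U).V)
    (hV : (plaquettePairCouplings U).V < 2 * (plaquettePairCouplings U).J) :
    (plaquettePairCouplings U).ΔEff ∈ Set.Ioc (-1:ℝ) 0 := by
  rw [plaquettePairCouplings_ΔEff]
  have h2J : 0 < 2 * (plaquettePairCouplings U).J := by positivity
  constructor
  · rw [neg_div, neg_lt_neg_iff, div_lt_one h2J]
    exact hV
  · rw [neg_div, neg_nonpos]
    exact div_nonneg hV0 h2J.le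

/-- The three parts give the anchor body at EVERY doping `δ ∈ (0, ¼]` of a window coupling `U`:
`Δ_eff(U) ∈ (-1, 0]` by the window arithmetic, `ρ_b = 2δ ∈ (0, ½]`, stub 2 at `(Δ_eff(U), 2δ)` feeds
stub 3. [bookkeeping] -/
theorem anchorOrderAt_of_parts {U : ℝ} (hU : 0 < U) (hW : PlaquetteWindowAt U)
    (hB : Sig.stub_easyPlaneCondensate) (hD : Sig.stub_dressing)
    {δ : ℝ} (hδ : δ ∈ Set.Ioc (0:ℝ) (1/4)) : AnchorOrderAt U δ := by
  obtain ⟨-, -, -, -, -, -, -, hJ, hV0, hV, -⟩ := id hW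
  have hΔ : (plaquettePairCouplings U).ΔEff ∈ Set.Ioc (-1:ℝ) 0 := ΔEff_mem_Ioc hJ hV0 hV
  have hρ : 2 * δ ∈ Set.Ioc (0:ℝ) (1/2) := ⟨by linarith [hδ.1], by linarith [hδ.2]⟩
  exact hD U hU hW δ hδ (hB _ hΔ _ hρ)

/-! ### Composition -/

/-- **The line closes the crux BY NAME modulo the three registered stubs.** Take the window coupling
`U` from stub 1, the witness doping `δ := 1/8 ∈ (0, 1/2)` (boson filling `¼`), and
`anchorOrderAt_of_parts`; the result is the crux body at `(U, 1/8)`. -/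
theorem PbAnchorOrder_of :
    Sig.stub_plaquetteWindow → Sig.stub_easyPlaneCondensate → Sig.stub_dressing → PbAnchorOrder := by
  rintro ⟨U, hU, hW⟩ hB hD
  have h : AnchorOrderAt U (1 / 8) :=
    anchorOrderAt_of_parts hU hW hB hD ⟨by norm_num, by norm_num⟩
  exact pbAnchorOrder_iff.2 ⟨U, hU, 1 / 8, ⟨by norm_num, by norm_num⟩, h⟩

/-- The skeleton in its final shape (A12): the crux BY NAME from the three registered stubs; it becomes
the crux proof when the last `stub_*` is discharged (until then it depends on `sorryAx` through the
stubs only — no `sorry` of its own). -/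
theorem PbAnchorOrder_proof : PbAnchorOrder :=
  PbAnchorOrder_of stub_plaquetteWindow stub_easyPlaneCondensate stub_dressing

end Summit.HubbardSuperconductivity.HubbardSuperconductivity.Cruxes.PbAnchorOrder.Birth

end
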